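import Literature.IUT.HodgeTheaters.DiscreteProfiniteConjugates
import Literature.GroupTheory.CombinatorialGroupTheory.FreeGroupResiduallyFinite
import Mathlib.GroupTheory.FreeGroup.NielsenSchreier
import Mathlib.Algebra.FreeAbelianGroup.Finsupp
import Mathlib.GroupTheory.Nilpotent
import HarnessLib

/-!
# [IUTchI] Lemma 2.7: proofs (free case) — proof-only companion of `DiscreteProfiniteConjugates`

Mochizuki, *Inter-universal Teichmüller theory I*, kurims manuscript (May 2020), §2, Lemma 2.7
"Well-known Properties of Free Groups and Orientable Surface Groups", pp. 57–59
[cite: Mochizuki2012, Lem 2.7 pp.57-59].  The seven named statements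
`FreeOrSurface.twoGeneratedSubgroupFree` … `autFixingCommutatorKernelTrivial` of
`Literature.IUT.HodgeTheaters.DiscreteProfiniteConjugates` quantify over groups `G` that are EITHER
free of finite rank OR orientable surface groups (`IsFreeOrSurface`).  This file DISCHARGES the
free-group half of the discrete assertions (i), (ii), (iv) unconditionally, the free-group half of
(iii) relative to residual nilpotent-finiteness (the pro-`l` form of residual finiteness,
[SemiAnbd] Remark 1.7.1), and records the formal reductions isolating exactly what the
surface-group half still requires:

* `isFreeGroup_of_isFreeOfFiniteRank` — a free group of finite rank is a free group (Mathlib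
  `IsFreeGroup`), so Nielsen–Schreier (`subgroupIsFreeOfIsFree`) applies to its subgroups;
* (i)  `twoGeneratedSubgroupFree_freeCase` — "any subgroup of a free group is free" (p. 58);
* (iv) `isCyclic_of_isFreeGroup_of_comm`, `abelianSubgroupCyclic_freeCase` — an abelian subgroup
  of a free group is free (Nielsen–Schreier) and abelian, hence has at most one free generator,
  hence is cyclic;
* (ii) `exists_finiteIndex_abelianization_of_ne_one` — Mochizuki's argument on p. 58, valid for ANY
  residually finite group: "there exists a finite index normal subgroup `G₀ ⊆ G` such that
  `x ∉ G₀` … take `G₁` to be the subgroup generated by `G₀` and `x`"; with the tree's theorem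
  `freeGroup_residuallyFinite` this gives `separatesInAbelianization_freeCase`;
* (iii) `rankTwoInAbelianization_freeCase_of_residuallyNilpotentFinite` — for noncommuting `x, y`
  in a free group that is residually *finite-nilpotent*, `x` and `y` themselves (`n = 1`) have
  `ℤ`-independent images in the abelianization of the finite-index subgroup
  `G₁ = φ⁻¹⟨φ x, φ y⟩`, `φ : G → Q` a finite nilpotent quotient with `φ [x, y] ≠ 1`: a dependence
  would make `⟨x̄, ȳ⟩ ⊆ G₁^{ab}` cyclic (abelianizations of subgroups of free groups are
  torsion-free), hence `⟨φ x, φ y⟩^{ab}` cyclic, hence — nilpotent groups with cyclic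
  abelianization are cyclic — `φ x`, `φ y` commute;
* reductions `…_of_surfaceCase`: each of (i), (ii), (iv) follows from its surface-group half, and
  (ii) for surface groups follows from their residual finiteness alone.

No new definitions; nothing here concerns the profinite assertions (v)–(vii) (but recall
`autFixingCommutatorKernelTrivial_of_centralizer` : (vi) ⇒ (vii) in the statement file).
-/

namespace Literature.IUT.HodgeTheaters

namespace FreeOrSurface

open Subgroup

universe u

/-! ### Free groups of finite rank are free groups; residual finiteness -/

/-- A free group of finite rank (`G ≅ F_n`, Thm 2.6 p. 56) is a free group in Mathlib's sense.
[cite: Mochizuki2012, Thm 2.6 p.56] -/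
theorem isFreeGroup_of_isFreeOfFiniteRank {G : Type u} [Group G] (hG : IsFreeOfFiniteRank G) :
    IsFreeGroup G := by
  obtain ⟨n, ⟨e⟩⟩ := hG
  exact IsFreeGroup.ofMulEquiv e.symm

/-- Residual finiteness is transported along group isomorphisms. [cite: Mochizuki2012, Lem 2.7(ii) p.58] -/
theorem residuallyFinite_of_mulEquiv {G : Type*} [Group G] {H : Type*} [Group H]
    [Group.ResiduallyFinite H] (e : G ≃* H) : Group.ResiduallyFinite G := by
  rw [Group.residuallyFinite_iff_exists_finiteIndex]
  intro g hg
  obtain ⟨N, hN⟩ := Group.exists_finiteIndexNormalSubgroup_notMem (e g)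
    (by simpa only [ne_eq, EmbeddingLike.map_eq_one_iff] using hg)
  refine ⟨N.toSubgroup.comap e.toMonoidHom, ?_, ?_⟩
  · constructor
    rw [Subgroup.index_comap_of_surjective _ e.surjective]
    exact N.toSubgroup.index_ne_zero_of_finite
  · simpa only [Subgroup.mem_comap, MulEquiv.coe_toMonoidHom,
      FiniteIndexNormalSubgroup.mem_toSubgroup_iff] using hN

/-- "Since `G` is residually finite [cf., e.g., [Config], Proposition 7.1, (ii)]" (p. 58): a free
group is residually finite — the tree's `freeGroup_residuallyFinite`, transported to any
`IsFreeGroup`. [cite: Mochizuki2012, Lem 2.7(ii) p.58] -/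
theorem residuallyFinite_of_isFreeGroup (G : Type u) [Group G] [IsFreeGroup G] :
    Group.ResiduallyFinite G :=
  haveI := Literature.GroupTheory.CombinatorialGroupTheory.freeGroup_residuallyFinite
    (IsFreeGroup.Generators G)
  residuallyFinite_of_mulEquiv (IsFreeGroup.toFreeGroup G)

/-! ### Lemma 2.7 (i), free case -/

/-- **Lemma 2.7 (i), free case** (p. 58: "If `G` is free, then assertion (i) follows from the
well-known fact that any subgroup of a free group is free" — Nielsen–Schreier, Mathlib
`subgroupIsFreeOfIsFree`). [cite: Mochizuki2012, Lem 2.7(i) p.58] -/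
theorem twoGeneratedSubgroupFree_freeCase (G : Type u) [Group G] (hG : IsFreeOfFiniteRank G)
    (x y : G) : IsFreeGroup (Subgroup.closure ({x, y} : Set G)) :=
  haveI := isFreeGroup_of_isFreeOfFiniteRank hG
  inferInstance

/-- Reduction for **Lemma 2.7 (i)**: the named statement follows from its orientable-surface-group
half (the free half being `twoGeneratedSubgroupFree_freeCase`). [cite: Mochizuki2012, Lem 2.7(i) p.58] -/
theorem twoGeneratedSubgroupFree_of_surfaceCase
    (hS : ∀ (G : Type u) [Group G], IsOrientableSurfaceGroup G →
      ∀ x y : G, IsFreeGroup (Subgroup.closure ({x, y} : Set G))) :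
    twoGeneratedSubgroupFree.{u} := by
  intro G _ hG x y
  rcases hG with hF | hSfc
  · exact twoGeneratedSubgroupFree_freeCase G hF x y
  · exact hS G hSfc x y

/-! ### Lemma 2.7 (iv), free case -/

/-- Two distinct free generators of a free group do not commute (seen in the symmetric group on
three letters). [cite: Mochizuki2012, Lem 2.7(iv) p.58] -/
theorem of_mul_of_ne_comm {H : Type u} [Group H] [IsFreeGroup H] {a b : IsFreeGroup.Generators H}
    (hab : a ≠ b) : IsFreeGroup.of a * IsFreeGroup.of b ≠ IsFreeGroup.of b * IsFreeGroup.of a := by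
  classical
  let f : IsFreeGroup.Generators H → Equiv.Perm (Fin 3) := fun c =>
    if c = a then Equiv.swap 0 1 else if c = b then Equiv.swap 1 2 else 1
  have hfa : f a = Equiv.swap 0 1 := by simp [f]
  have hfb : f b = Equiv.swap 1 2 := by simp [f, Ne.symm hab]
  intro h
  have h' := congrArg (IsFreeGroup.lift f) h
  simp only [map_mul, IsFreeGroup.lift_of, hfa, hfb] at h'
  exact absurd h' (by decide)

/-- A free group all of whose elements commute is cyclic: it has at most one free generator
(p. 58, proof of (iv): "any abelian subgroup of `G` generated by two elements is free, hence
cyclic"). [cite: Mochizuki2012, Lem 2.7(iv) p.58] -/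
theorem isCyclic_of_isFreeGroup_of_comm (H : Type u) [Group H] [IsFreeGroup H]
    (hc : ∀ a b : H, a * b = b * a) : IsCyclic H := by
  have hsub : Subsingleton (IsFreeGroup.Generators H) := by
    refine ⟨fun a b => by_contra fun hab => ?_⟩
    exact of_mul_of_ne_comm hab (hc _ _)
  -- every element lies in the subgroup generated by the (at most one) generator
  rcases isEmpty_or_nonempty (IsFreeGroup.Generators H) with hE | ⟨⟨a⟩⟩
  · haveI : Subsingleton H := by
      refine ⟨fun x y => ?_⟩
      have hx : ∀ z : H, z = 1 := fun z => by
        have hz := (IsFreeGroup.toFreeGroup H).symm_apply_apply z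
        rw [← hz]
        induction (IsFreeGroup.toFreeGroup H) z using FreeGroup.induction_on with
        | C1 => simp
        | of c => exact isEmptyElim c
        | inv_of c _ => exact isEmptyElim c
        | mul p q hp hq => rw [map_mul, hp, hq, one_mul]
      rw [hx x, hx y]
    infer_instance
  · refine ⟨⟨IsFreeGroup.of a, fun x => ?_⟩⟩
    have hx := (IsFreeGroup.toFreeGroup H).symm_apply_apply x
    have hmem : ∀ w : FreeGroup (IsFreeGroup.Generators H),
        (IsFreeGroup.toFreeGroup H).symm w ∈ Subgroup.zpowers (IsFreeGroup.of a) := by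
      intro w
      induction w using FreeGroup.induction_on with
      | C1 => simp
      | of c =>
        rw [Subsingleton.elim c a]
        have : (IsFreeGroup.toFreeGroup H).symm (FreeGroup.of a) = IsFreeGroup.of a := by
          simp [IsFreeGroup.toFreeGroup, IsFreeGroup.of]
        rw [this]
        exact Subgroup.mem_zpowers _
      | inv_of c hc' => rw [map_inv]; exact Subgroup.inv_mem _ hc'
      | mul p q hp hq => rw [map_mul]; exact Subgroup.mul_mem _ hp hq
    obtain ⟨k, hk⟩ := Subgroup.mem_zpowers_iff.mp (hmem (IsFreeGroup.toFreeGroup H x))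
    exact ⟨k, by simpa [hx] using hk⟩

/-- **Lemma 2.7 (iv), free case**: any abelian subgroup of a free group of finite rank is cyclic
(Nielsen–Schreier: it is free, and abelian, hence of rank `≤ 1`). [cite: Mochizuki2012, Lem 2.7(iv) p.58] -/
theorem abelianSubgroupCyclic_freeCase (G : Type u) [Group G] (hG : IsFreeOfFiniteRank G)
    (J : Subgroup G) (hJ : ∀ a ∈ J, ∀ b ∈ J, a * b = b * a) : IsCyclic J := by
  haveI := isFreeGroup_of_isFreeOfFiniteRank hG
  exact isCyclic_of_isFreeGroup_of_comm J fun a b => Subtype.ext (hJ a a.2 b b.2)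

/-- Reduction for **Lemma 2.7 (iv)**: the named statement follows from its orientable-surface-group
half. [cite: Mochizuki2012, Lem 2.7(iv) p.58] -/
theorem abelianSubgroupCyclic_of_surfaceCase
    (hS : ∀ (G : Type u) [Group G], IsOrientableSurfaceGroup G →
      ∀ J : Subgroup G, (∀ a ∈ J, ∀ b ∈ J, a * b = b * a) → IsCyclic J) :
    abelianSubgroupCyclic.{u} := by
  intro G _ hG J hJ
  rcases hG with hF | hSfc
  · exact abelianSubgroupCyclic_freeCase G hF J hJ
  · exact hS G hSfc J hJ

/-! ### Lemma 2.7 (ii): residually finite groups; free case -/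

open scoped IsMulCommutative in
/-- The argument printed for **Lemma 2.7 (ii)** (p. 58), valid in ANY residually finite group:
"there exists a finite index normal subgroup `G₀ ⊆ G` such that `x ∉ G₀`.  Thus, it suffices to
take `G₁` to be the subgroup of `G` generated by `G₀` and `x`" — indeed `G₁ ↠ G₁/G₀ = ⟨x̄⟩` is a
homomorphism to an abelian group not killing `x`, so `x` is nontrivial in `G₁^{ab}`.
[cite: Mochizuki2012, Lem 2.7(ii) p.58] -/
theorem exists_finiteIndex_abelianization_of_ne_one {G : Type u} [Group G]
    [Group.ResiduallyFinite G] (x : G) (hx : x ≠ 1) :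
    ∃ (G₁ : Subgroup G) (hx₁ : x ∈ G₁), G₁.FiniteIndex ∧
      Abelianization.of (⟨x, hx₁⟩ : G₁) ≠ 1 := by
  obtain ⟨N, hN⟩ := Group.exists_finiteIndexNormalSubgroup_notMem x hx
  -- the cyclic subgroup of the finite quotient generated by the image of `x`
  let π : G →* G ⧸ N.toSubgroup := QuotientGroup.mk' N.toSubgroup
  let C : Subgroup (G ⧸ N.toSubgroup) := Subgroup.zpowers (π x)
  let G₁ : Subgroup G := C.comap π
  have hxG₁ : x ∈ G₁ := Subgroup.mem_comap.mpr (Subgroup.mem_zpowers _)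
  have hker : π.ker ≤ G₁ := fun g hg => by
    rw [MonoidHom.mem_ker] at hg
    simp [G₁, Subgroup.mem_comap, hg]
  haveI : π.ker.FiniteIndex := by
    rw [QuotientGroup.ker_mk']
    infer_instance
  refine ⟨G₁, hxG₁, Subgroup.finiteIndex_of_le hker, ?_⟩
  -- `G₁ → C` is a homomorphism to an abelian group sending `x` to `π x ≠ 1`
  let ψ : G₁ →* C := π.subgroupComap C
  haveI : IsMulCommutative C := Subgroup.zpowers_isMulCommutative (π x)
  intro h1
  have h2 := congrArg (Abelianization.lift ψ) h1
  rw [Abelianization.lift_apply_of, map_one] at h2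
  have h3 : (ψ ⟨x, hxG₁⟩ : G ⧸ N.toSubgroup) = π x := rfl
  rw [h2] at h3
  have h4 : π x = 1 := by simpa using h3.symm
  exact hN ((QuotientGroup.eq_one_iff x).mp h4)

/-- **Lemma 2.7 (ii), free case**: for `x ≠ 1` in a free group of finite rank there is a finite
index subgroup `G₁ ∋ x` in whose abelianization `x` is nontrivial.
[cite: Mochizuki2012, Lem 2.7(ii) p.58] -/
theorem separatesInAbelianization_freeCase (G : Type u) [Group G] (hG : IsFreeOfFiniteRank G)
    (x : G) (hx : x ≠ 1) :
    ∃ (G₁ : Subgroup G) (hx₁ : x ∈ G₁), G₁.FiniteIndex ∧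
      Abelianization.of (⟨x, hx₁⟩ : G₁) ≠ 1 := by
  haveI := isFreeGroup_of_isFreeOfFiniteRank hG
  haveI := residuallyFinite_of_isFreeGroup G
  exact exists_finiteIndex_abelianization_of_ne_one x hx

/-- Reduction for **Lemma 2.7 (ii)**: the named statement follows from the residual finiteness of
orientable surface groups (the free half and the deduction from residual finiteness being proved
above). [cite: Mochizuki2012, Lem 2.7(ii) p.58] -/
theorem separatesInAbelianization_of_surfaceResiduallyFinite
    (hS : ∀ (G : Type u) [Group G], IsOrientableSurfaceGroup G → Group.ResiduallyFinite G) :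
    separatesInAbelianization.{u} := by
  intro G _ hG x hx
  rcases hG with hF | hSfc
  · exact separatesInAbelianization_freeCase G hF x hx
  · haveI := hS G hSfc
    exact exists_finiteIndex_abelianization_of_ne_one x hx

end FreeOrSurface

end Literature.IUT.HodgeTheaters
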